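import Summits.ResolutionOfSingularities.ResolutionOfSingularities.Theorems.EquisingularLiftEquisingularLiftNatTowerBTransportFour
import Summits.ResolutionOfSingularities.ResolutionOfSingularities.Theorems.EquisingularLiftEquisingularLiftNatSubchainSupplierInvSLDefs
import HarnessLib

/-!
# [OURS · L1 W4.5(b) · EL♮(3) · T23-A‴ (U6)] LETTER TRANSPORT through an in-carrier point step: rule (D‴5′) of res-L1-w45b-stub-4's ENGINE WORD v1.1
# f996922ad41a17f2 — (a) AWAY (`y ∉ L`: the model is carried, `𝓛 ↦ 𝓛·𝒪_{X₂}`) and (c′) THROUGH THE POINT with `Z ⊄ L` (model-less: topology only)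

res-type-027 g18 ((U6) owner), brick (F4). Crux `EquisingularLiftNatThree` = stmt-ResolutionOfSingularities-20148 (parent stmt-…-20038), route `EquisingularLift`,
line `sections`. OURS; NOT a statement of any manuscript ([Hironaka2017] is a candidate under adjudication, nothing of it is asserted); AI-written, weaker than
expert review. DEF-FREE; no `sorry`; standard axioms; `--supports stmt-ResolutionOfSingularities-20148 --as helper`.

WHAT. `TCPlus.letterDatum_transport_away` — the stage-level twin of res-L1-w45b-stub-2's `Tower.exc₄_transport_away` (…NatTowerBTransportFour p625145,
itself the model arm of res-L1-w45b-stub-4's B-AWAY): a letter `L` with datum `LetterDatum O P q Y G X σ jG L` (…NatSubchainSupplierInvSLDefs) at a stage `X`,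
a blow-up `τ : X₂ → X` along a centre `C` all of whose members' models missing `jG pt` are disjoint from `C` (`hdisj`, the section / fat-point centre of an
in-carrier step: `disjoint_support_of_inter_fibre_eq_singleton`), the downstairs blow-up `υ₁` of a centre supported at `{pt}` with `j₂ ≫ τ = υ₁ ≫ jG`, and
`pt ∉ L`: then `closure υ₁⁻¹(L ∖ {pt})` carries `LetterDatum O P q Y G₂ X₂ (τ ≫ σ) j₂ ·` with model `𝓛·𝒪_{X₂}` (trace by
`IsBlowup.comap_vanishingIdeal_of_disjoint`, principal `isPrincipal_stalkIdeal_comap`, regular `isRegular_subscheme_comap_of_disjoint`, flat through the iso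
`V(𝓛·𝒪_{X₂}) ≅ V(𝓛)` of `exists_iso_subscheme_comap_of_disjoint`). `TCPlus.letter_modelless_bookkeeping` — (c′): `St L` is closed and does not contain the
new running curve (`not_closure_preimage_diff_subset`, …NatTowerBPointSteps). `TCPlus.letters_transport_away` — the list form.

References: U. Görtz, T. Wedhorn, *Algebraic Geometry I* (2020), Prop. 13.91 (3), (13.19) [GortzWedhorn2020]; The Stacks Project, Tags 02OS, 033B
[StacksProject] — through the cited tree files.
-/

set_option linter.dupNamespace false -- mandated namespace `Summit.<Summit>.<Problem>` of this single-conjunct summit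

noncomputable section

open CategoryTheory CategoryTheory.Limits AlgebraicGeometry TopologicalSpace Topology IsLocalRing
open Literature.AlgebraicGeometry.Resolution
open AlgebraicGeometry.Scheme.IdealSheafData

namespace Summit.ResolutionOfSingularities.ResolutionOfSingularities.Cruxes.EquisingularLiftNat.Sections.TCPlus

section Away

variable (O : Type) [CommRing O] (P : Scheme.{0}) (q : P ⟶ Spec (.of O)) (Y : Set P)
  {X X₂ G G₂ : Scheme.{0}} {σ : X ⟶ P} {jG : G ⟶ X} [IsLocallyNoetherian G]
  {τ : X₂ ⟶ X} {C : X.IdealSheafData} (hτ : IsBlowup τ C)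
  {pt : G} {υ₁ : G₂ ⟶ G} {J : G.IdealSheafData} (hυ₁ : IsBlowup υ₁ J) (hJ : (J.support : Set G) = {pt})
  {j₂ : G₂ ⟶ X₂} (hcomm : j₂ ≫ τ = υ₁ ≫ jG)
  (hdisj : ∀ I : X.IdealSheafData, jG pt ∉ (I.support : Set X) → Disjoint (I.support : Set X) (C.support : Set X))

include hτ hυ₁ hJ hcomm hdisj

/-- **(a) AWAY: a letter through a point step OFF it keeps its model** (`𝓛 ↦ 𝓛·𝒪_{X₂}`; see the module docstring).
[cite: GortzWedhorn2020, Prop. 13.91 (3) and (13.19)] [cite: StacksProject, Tags 02OS, 033B] [OURS · L1 W4.5b · T23-A‴ (U6), rule (D‴5′)(a)];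
NOT a statement of the manuscript. -/
theorem letterDatum_transport_away {L : Set G} (hLcl : IsClosed L) (hL : LetterDatum O P q Y G X σ jG L) (hptL : pt ∉ L) :
    LetterDatum O P q Y G₂ X₂ (τ ≫ σ) j₂ (closure (υ₁ ⁻¹' (L \ {pt}))) := by
  -- adapted from res-L1-w45b-stub-2's `Tower.exc₄_transport_away` (…NatTowerBTransportFour): same four transports, flatness through the iso
  obtain ⟨𝓛, hl1, hl2, hl3, hl4, hl5⟩ := hL
  have hLc : closure L = L := hLcl.closure_eq
  have hl1' : 𝓛.comap jG = vanishingIdeal (⟨L, hLcl⟩ : Closeds G) := by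
    rw [hl1]; congr 1; exact Closeds.ext hLc
  -- the model misses the centre: its trace misses `pt`
  have hptsupp : jG pt ∉ (𝓛.support : Set X) := by
    intro hmem
    have h1 : pt ∈ ((𝓛.comap jG).support : Set G) := by rw [support_comap]; exact hmem
    rw [hl1', Scheme.IdealSheafData.coe_support_vanishingIdeal] at h1
    exact hptL h1
  have hd : Disjoint (𝓛.support : Set X) (C.support : Set X) := hdisj 𝓛 hptsupp
  obtain ⟨e, he⟩ := exists_iso_subscheme_comap_of_disjoint hτ 𝓛 hd
  -- downstairs: `closure υ₁⁻¹(L ∖ {pt}) = υ₁⁻¹ L`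
  have hDL : Disjoint ({pt} : Set G) L := Set.disjoint_singleton_left.mpr hptL
  have hLD : L \ {pt} = L := sdiff_eq_left.mpr hDL.symm
  have hcl : closure (υ₁ ⁻¹' (L \ {pt})) = υ₁ ⁻¹' L := by
    rw [hLD]; exact (hLcl.preimage υ₁.continuous).closure_eq
  refine ⟨𝓛.comap τ, ?_, fun z => isPrincipal_stalkIdeal_comap τ 𝓛 z (hl2 (τ z)), isRegular_subscheme_comap_of_disjoint hτ 𝓛 hd hl3, ?_, ?_⟩
  · -- (l-i) the trace: pull the reduced ideal of `L` back along `υ₁` (disjoint from the centre `{pt} = supp J`)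
    have hdisj' : Disjoint ((⟨L, hLcl⟩ : Closeds G) : Set G) (J.support : Set G) := by rw [hJ]; exact hDL.symm
    rw [← Scheme.IdealSheafData.comap_comp, hcomm, Scheme.IdealSheafData.comap_comp, hl1',
      hυ₁.comap_vanishingIdeal_of_disjoint _ hdisj']
    congr 1
    refine Closeds.ext ?_
    change υ₁ ⁻¹' L = closure (closure (υ₁ ⁻¹' (L \ {pt})))
    rw [closure_closure, hcl]
  · -- (l-iv) off the generic point of `Y`
    rintro _ ⟨z, hz, rfl⟩
    have hz' : τ z ∈ (𝓛.support : Set X) := by rw [support_comap] at hz; exact hz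
    rw [Scheme.Hom.comp_apply]
    exact hl4 ⟨τ z, hz', rfl⟩
  · -- (l-v) flat over `O` through the iso `V(𝓛·𝒪_{X₂}) ≅ V(𝓛)`
    have hfac : (𝓛.comap τ).subschemeι ≫ (τ ≫ σ) ≫ q = e.hom ≫ (𝓛.subschemeι ≫ σ ≫ q) := by
      rw [← Category.assoc e.hom, he, Category.assoc, Category.assoc]
    rw [hfac]
    haveI := hl5
    infer_instance

/-- **The list form of (a)**: every letter OFF the point is transported with its model. [OURS · pure logic over `letterDatum_transport_away`] -/
theorem letters_transport_away {Ls : List (Set G)} (hLs : ∀ L ∈ Ls, IsClosed L ∧ LetterDatum O P q Y G X σ jG L) :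
    ∀ L ∈ Ls, pt ∉ L → LetterDatum O P q Y G₂ X₂ (τ ≫ σ) j₂ (closure (υ₁ ⁻¹' (L \ {pt}))) :=
  fun L hL hptL => letterDatum_transport_away O P q Y hτ hυ₁ hJ hcomm hdisj (hLs L hL).1 (hLs L hL).2 hptL

end Away

/-! ## (c′) and the downstairs bookkeeping of letters -/

/-- **(c′)/bookkeeping: a transported letter is closed and does not contain the new running curve** (`T` irreducible, `T ⊄ L`, `T ⊄ {pt}`).
[OURS · pure topology over `not_closure_preimage_diff_subset` (…NatTowerBPointSteps)] -/
theorem letter_bookkeeping {G G₂ : Scheme.{0}} [IsLocallyNoetherian G] {υ₁ : G₂ ⟶ G} {J : G.IdealSheafData} (hυ₁ : IsBlowup υ₁ J)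
    {pt : G} (hJ : (J.support : Set G) = {pt}) (hpt : IsClosed ({pt} : Set G)) {T L : Set G} (hTirr : IsIrreducible T) (hL : IsClosed L)
    (hTL : ¬ T ⊆ L) (hTpt : ¬ T ⊆ {pt}) :
    IsClosed (closure (υ₁ ⁻¹' (L \ {pt}))) ∧ ¬ closure (υ₁ ⁻¹' (T \ {pt})) ⊆ closure (υ₁ ⁻¹' (L \ {pt})) :=
  ⟨isClosed_closure, not_closure_preimage_diff_subset hυ₁ hTirr hL hpt hTL hTpt hJ.le⟩

end Summit.ResolutionOfSingularities.ResolutionOfSingularities.Cruxes.EquisingularLiftNat.Sections.TCPlus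

end
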